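import Summits.NavierStokesRegularity.NavierStokesRegularity.Theorems.FilamentSkeletonRssTransverseReductionRStraight
import Mathlib.MeasureTheory.Measure.Lebesgue.VolumeOfBalls

/-!
# Route `FilamentSkeletonRss` · crux `TransverseReductionR` (stmt-NavierStokesRegularity-19175) — census, third cut, and the route dichotomy

Refutation-first lane `ns-filament-19175-p1`, third cut (2026-08-27).  Two pieces of negative-side
bookkeeping on top of the census files p528784 (`transverseReductionR_iff_nondegenerate`) and p537154
(`transverseReductionR_iff_posCurvature`):

* `TransverseReductionRPacking.card_mul_cube_le` — WAIST PACKING: `N` points in the ball `‖y‖ ≤ R` of `ℝ³`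
  with mutual distances `≥ r > 0` satisfy `N r³ ≤ (r + 2R)³` (disjoint balls of radius `r/2` inside the ball
  of radius `R + r/2`; Lebesgue measure).  Applied to the waists `X_j(c_j)` (`‖X_j(c_j)‖ ≤ Rw√Γ`,
  separation `ρ√Γ`): a box needs `N ρ³ ≤ (ρ + 2 Rw)³`, at every `Γ > 0`.
* `transverseReductionR_iff_packing` — the SURVIVING REDUCED STATEMENT, third cut: the crux is equivalent
  to its restriction to `cg ≤ 1 ∧ θ₀ ≤ 1 ∧ 0 < K ∧ 3/2 + δ ≤ Λ ∧ 0 ≤ cnd ∧ (2 ≤ N → ρ ≤ 2 Rw) ∧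
  N ρ³ ≤ (ρ + 2 Rw)³`; the number of cores is bounded by the waist/separation geometry, uniformly in `Γ`.
* `transverseReductionR_and_not_selectionBoxR_of_boxEmpty` — the ROUTE DICHOTOMY behind the lane's verdict:
  the box blocks of `TransverseReductionR` and of the sibling crux `SelectionBoxR` (stmt-19174) are the same
  text, so if the tilted box class is EVENTUALLY EMPTY (for every parameter tuple, no box at any large `Γ`)
  then `TransverseReductionR` holds VACUOUSLY and `SelectionBoxR` is FALSE — a vacuous closure of this crux
  kills the route (`closes` consumes both).  Together with p528784's `not_transverseReductionR_iff_boxWitness`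
  (`¬ TransverseReductionR` needs an inhabited box on which every reduced family fails) this is the formal
  content of «the route sign is decided at inhabitation»: either the class is eventually empty (19175 ✓,
  19174 ✗), or it is inhabited along a sequence `Γ → ∞` and the crux is the genuine gluing question there.
  The desk test recorded on the item (`TESTS-19175-g3.md`: the inner-scale normal balance is free — binormal
  self-induction `(Γγ/4π) κ log` absorbs any `O(√Γ)` normal velocity with curvature `O(1/(√Γ log Γ)) ≪ K/√Γ`;
  the ball-local class evades the exact-skeleton obstruction of Cruxes/SkeletonEquilibrium by design) points
  to the second branch; it is NOT formalised here.

Negative-side bookkeeping (`--supports` stmt-19175); NOT a claim about NS regularity or blow-up.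
-/

set_option linter.dupNamespace false

noncomputable section

namespace Summit.NavierStokesRegularity.NavierStokesRegularity.Theorems

open Set Function Filter MeasureTheory Real
open Literature.Analysis.FluidPDE
open Summit.NavierStokesRegularity.NavierStokesRegularity.Theses.FilamentSkeletonRss
open scoped InnerProductSpace Topology

namespace TransverseReductionRPacking

/-- Volume of a ball of radius `r ≥ 0` in `ℝ³`, as a real number: `(4π/3) r³`. [folklore] -/
theorem volume_real_ball_three (x : EuclideanSpace ℝ (Fin 3)) {r : ℝ} (hr : 0 ≤ r) :
    volume.real (Metric.ball x r) = r ^ 3 * (π * 4 / 3) := by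
  rw [measureReal_def, EuclideanSpace.volume_ball_fin_three, ENNReal.toReal_mul, ENNReal.toReal_pow,
    ENNReal.toReal_ofReal hr, ENNReal.toReal_ofReal (by positivity)]

/-- **Waist packing.** `N` points of `ℝ³` in the ball `‖y‖ ≤ R` with mutual distances at least `r > 0`
satisfy `N r³ ≤ (r + 2R)³`: the balls of radius `r/2` about them are disjoint and lie in the ball of
radius `R + r/2` about the origin (compare Lebesgue measures). [folklore] -/
theorem card_mul_cube_le {N : ℕ} (P : Fin N → EuclideanSpace ℝ (Fin 3)) {r R : ℝ} (hr : 0 < r)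
    (hR : 0 ≤ R) (hnorm : ∀ j, ‖P j‖ ≤ R) (hsep : ∀ j k, j ≠ k → r ≤ ‖P j - P k‖) :
    (N : ℝ) * r ^ 3 ≤ (r + 2 * R) ^ 3 := by
  set B : Fin N → Set (EuclideanSpace ℝ (Fin 3)) := fun j => Metric.ball (P j) (r / 2) with hB
  have hdisj : Pairwise (Disjoint on B) := fun j k hjk => by
    apply Metric.ball_disjoint_ball
    rw [dist_eq_norm]
    linarith [hsep j k hjk]
  have hmeas : ∀ j, MeasurableSet (B j) := fun j => measurableSet_ball
  have hsub : (⋃ j, B j) ⊆ Metric.ball (0 : EuclideanSpace ℝ (Fin 3)) (R + r / 2) := by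
    intro x hx
    obtain ⟨j, hj⟩ := Set.mem_iUnion.1 hx
    rw [Metric.mem_ball, dist_eq_norm] at hj
    rw [Metric.mem_ball, dist_zero_right]
    calc ‖x‖ = ‖(x - P j) + P j‖ := by rw [sub_add_cancel]
      _ ≤ ‖x - P j‖ + ‖P j‖ := norm_add_le _ _
      _ < r / 2 + R := add_lt_add_of_lt_of_le hj (hnorm j)
      _ = R + r / 2 := by ring
  have h1 : volume.real (⋃ j, B j) = ∑ j, volume.real (B j) := measureReal_iUnion_fintype hdisj hmeas
  have h2 : ∑ j : Fin N, volume.real (B j) = (N : ℝ) * ((r / 2) ^ 3 * (π * 4 / 3)) := by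
    simp only [hB, volume_real_ball_three _ (by positivity : (0:ℝ) ≤ r / 2), Finset.sum_const,
      Finset.card_univ, Fintype.card_fin, nsmul_eq_mul]
  have h3 : volume.real (⋃ j, B j) ≤
      volume.real (Metric.ball (0 : EuclideanSpace ℝ (Fin 3)) (R + r / 2)) := measureReal_mono hsub
  rw [h1, h2, volume_real_ball_three _ (by positivity : (0:ℝ) ≤ R + r / 2)] at h3
  have hπ : 0 < π * 4 / 3 := by positivity
  have h4 : (N : ℝ) * (r / 2) ^ 3 ≤ (R + r / 2) ^ 3 := by
    have := h3
    rw [← mul_assoc] at this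
    exact le_of_mul_le_mul_right this hπ
  have h5 : (r + 2 * R) ^ 3 = 8 * (R + r / 2) ^ 3 := by ring
  rw [h5]
  nlinarith [h4]

/-- The waist-packing condition of a box: waists `‖X_j(c_j)‖ ≤ Rw√Γ` and separation `ρ√Γ` between
distinct filaments force `N ρ³ ≤ (ρ + 2 Rw)³` (any `Γ > 0`). [folklore] -/
theorem packing_of_box {N : ℕ} {ρ Rw Γ : ℝ} (hΓ : 0 < Γ) (hρ : 0 < ρ) (hRw : 0 < Rw)
    {X : Fin N → ℝ → EuclideanSpace ℝ (Fin 3)} {c : Fin N → ℝ}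
    (hsep : ∀ j k, j ≠ k → ∀ τ σ, ρ * √Γ ≤ ‖X j τ - X k σ‖) (hwaist : ∀ j, ‖X j (c j)‖ ≤ Rw * √Γ) :
    (N : ℝ) * ρ ^ 3 ≤ (ρ + 2 * Rw) ^ 3 := by
  have hs : 0 < √Γ := Real.sqrt_pos.2 hΓ
  have h := card_mul_cube_le (fun j => X j (c j)) (mul_pos hρ hs) (mul_pos hRw hs).le hwaist
    (fun j k hjk => hsep j k hjk (c j) (c k))
  have h' : (ρ * √Γ + 2 * (Rw * √Γ)) ^ 3 = (ρ + 2 * Rw) ^ 3 * (√Γ) ^ 3 := by ring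
  rw [mul_pow, ← mul_assoc, h'] at h
  exact le_of_mul_le_mul_right h (pow_pos hs 3)

end TransverseReductionRPacking

open TransverseReductionRPacking TransverseReductionRCensus in
/-- **Parameter census, third cut: the number of cores is bounded by the waist geometry.**
`TransverseReductionR` is equivalent to its restriction to the region
`cg ≤ 1 ∧ θ₀ ≤ 1 ∧ 0 < K ∧ 3/2 + δ ≤ Λ ∧ 0 ≤ cnd ∧ (2 ≤ N → ρ ≤ 2 Rw) ∧ N ρ³ ≤ (ρ + 2 Rw)³`.
New over `transverseReductionR_iff_posCurvature` (p537154): the waist-packing inequality — `N` waists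
`X_j(c_j)` inside `‖y‖ ≤ Rw√Γ`, pairwise `ρ√Γ` apart, carry disjoint balls of radius `ρ√Γ/2` inside the
ball of radius `(Rw + ρ/2)√Γ`, so `N (ρ/2)³ ≤ (Rw + ρ/2)³`; if it fails, the box hypotheses are contradictory
at every `Γ ≥ 1` and the crux holds vacuously.  A prover may assume `N ≤ (1 + 2Rw/ρ)³`; a refuter's
witness has at most that many cores.  Negative-side bookkeeping; NOT a claim about NS regularity or
blow-up. [folklore] -/
theorem transverseReductionR_iff_packing :
    TransverseReductionR ↔
    (∀ (N:ℕ) (δ ρ K Λ a b cnd η Rw Rb cg θ₀:ℝ), 0 < N → 0 < δ → 0 < ρ → 0 < η → 0 < Rw → 0 < Rb → 0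
      < cg → 0 < θ₀ → cg ≤ 1 → θ₀ ≤ 1 → 0 < K → 3/2+δ ≤ Λ → 0 ≤ cnd → (2 ≤ N → ρ ≤ 2*Rw) → (N:ℝ)*ρ^3
      ≤ (ρ+2*Rw)^3 → ∃ Γ₁:ℝ, ∀ Γ:ℝ, Γ₁≤Γ → ∀ (γ:(Fin N → ℝ) → Fin N → ℝ) (α:(Fin N → ℝ) → ℝ) (X:(Fin
      N → ℝ) → Fin N → ℝ → EuclideanSpace ℝ (Fin 3)) (w:(Fin N → ℝ) → Fin N → ℝ → ℝ) (c:(Fin N → ℝ)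
      → Fin N → ℝ) (m n:(Fin N → ℝ) → Fin N → EuclideanSpace ℝ (Fin 3)) (u:(Fin N → ℝ)→(Fin N → ℝ →
      EuclideanSpace ℝ (Fin 3)) → EuclideanSpace ℝ (Fin 3) → EuclideanSpace ℝ (Fin 3)) (v:(Fin N →
      ℝ) → EuclideanSpace ℝ (Fin 3) → EuclideanSpace ℝ (Fin 3)) (A:(Fin N → ℝ) → Fin N →
      (EuclideanSpace ℝ (Fin 3) →L[ℝ] EuclideanSpace ℝ (Fin 3))) (T:(Fin N → ℝ)→(Fin N → ℝ →
      EuclideanSpace ℝ (Fin 3)) → Fin N → ℝ → EuclideanSpace ℝ (Fin 3)) (D:(Fin N → ℝ) → Fin N →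
      EuclideanSpace ℝ (Fin 3) → EuclideanSpace ℝ (Fin 3)), (∀ p Z y, u p Z y = ∑ k, (Γ*γ p
      k/(4*Real.pi)) • ∫ σ:ℝ, ((‖y-Z k σ‖^2+1)^(3/2:ℝ))⁻¹ • cross (deriv (Z k) σ) (y-Z k σ))→(∀ p y,
      v p y = u p (X p) y+(1/2:ℝ) • y-α p • cross (EuclideanSpace.single 2 1) y)→(∀ p j, A p j =
      fderiv ℝ (v p) (X p j (c p j)))→(∀ p Z j τ, T p Z j τ = (u p Z (Z j τ)+(1/2:ℝ) • Z j τ-α p •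
      cross (EuclideanSpace.single 2 1) (Z j τ))-(⟪u p Z (Z j τ)+(1/2:ℝ) • Z j τ-α p • cross
      (EuclideanSpace.single 2 1) (Z j τ), deriv (Z j) τ⟫_ℝ/‖deriv (Z j) τ‖^2) • deriv (Z j) τ)→(∀ p
      j y, D p j y = (Real.exp (-(⟪y-X p j (c p j), deriv (X p j) (c p j)⟫_ℝ)^2)*((1-Real.exp
      (-(‖y-X p j (c p j)‖^2-⟪y-X p j (c p j), deriv (X p j) (c p j)⟫_ℝ^2)))/(‖y-X p j (c p
      j)‖^2-⟪y-X p j (c p j), deriv (X p j) (c p j)⟫_ℝ^2))) • cross (deriv (X p j) (c p j)) (y-X p j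
      (c p j)))→((∀ j, ContinuousOn (fun q:(Fin N → ℝ) × ℝ => (α q.1, γ q.1 j, X q.1 j q.2, w q.1 j
      q.2)) ({p:Fin N → ℝ | ∀ i, p i ∈ Icc 0 1} ×ˢ univ))∧(∀ p:Fin N → ℝ, (∀ i, p i ∈ Icc 0 1) → α p
      ≠ 0 ∧ (∀ j, γ p j ≠ 0)∧(∀ j, ContDiff ℝ 2 (X p j) ∧ Differentiable ℝ (w p j)∧(∀ τ, ‖deriv (X p
      j) τ‖ = 1)∧(∀ τ, ‖iteratedDeriv 2 (X p j) τ‖*√Γ≤K) ∧ Tendsto (fun τ => ‖X p j τ‖) (cocompact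
      ℝ) atTop)∧(∀ j k, j ≠ k → ∀ τ σ, ρ*√Γ≤‖X p j τ-X p k σ‖)∧(∀ j τ σ, ρ*√Γ≤|τ-σ| → cg*ρ*√Γ≤‖X p j
      τ-X p j σ‖)∧(∀ j τ, cg*|τ-c p j|≤Rw*√Γ+‖X p j τ‖)∧(∀ j τ, w p j τ = ⟪v p (X p j τ), deriv (X p
      j) τ⟫_ℝ)∧(∀ j τ, ‖X p j τ‖≤Rb*√(Γ*Real.log Γ) → v p (X p j τ) = w p j τ • deriv (X p j) τ)∧(∀
      j, ‖X p j (c p j)‖≤Rw*√Γ)∧(∀ j, |⟪deriv (X p j) (c p j), EuclideanSpace.single 2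
      1⟫_ℝ|≤1-θ₀)∧(θ₀≤|α p| ∧ |α p|≤θ₀⁻¹ ∧ ∀ j, θ₀≤|γ p j| ∧ |γ p j|≤θ₀⁻¹)∧(∀ j, w p j (c p j) = 0 ∧
      (∀ τ, w p j τ = 0 → τ = c p j) ∧ 3/2+δ≤deriv (w p j) (c p j) ∧ deriv (w p j) (c p j)≤Λ)∧(∀ j,
      Orthonormal ℝ ![deriv (X p j) (c p j), m p j, n p j] ∧ ⟪A p j (m p j), m p j⟫_ℝ+⟪A p j (n p
      j), n p j⟫_ℝ < 0 ∧ ⟪A p j (n p j), m p j⟫_ℝ * ⟪A p j (m p j), n p j⟫_ℝ < ⟪A p j (m p j), m p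
      j⟫_ℝ * ⟪A p j (n p j), n p j⟫_ℝ)∧(∀ Y:Fin N → ℝ → EuclideanSpace ℝ (Fin 3), (∀ j, ContDiff ℝ 2
      (Y j))→(∀ j τ, ⟪Y j τ, deriv (X p j) τ⟫_ℝ = 0) → ∑ j, ⟪Y j (c p j), cross
      (EuclideanSpace.single 2 1) (X p j (c p j))⟫_ℝ = 0 → (∀ j τ, ‖Y j τ‖+‖deriv (Y j)
      τ‖+‖iteratedDeriv 2 (Y j) τ‖≤(1+|τ-c p j|)^b) → ∀ L:ℝ, (∀ j τ, ‖deriv (fun s:ℝ => T p (fun k σ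
      => X p k σ+s • Y k σ) j τ) 0‖≤L*(1+|τ-c p j|)^a) → ∀ j τ, ‖Y j τ‖≤cnd*L*(1+|τ-c p j|)^b))) → ∃
      (C₀ M:ℝ) (U:(Fin N → ℝ) → EuclideanSpace ℝ (Fin 3) → EuclideanSpace ℝ (Fin 3)) (P:(Fin N → ℝ)
      → EuclideanSpace ℝ (Fin 3) → ℝ) (B:(Fin N → ℝ) → Fin N → ℝ), (ContinuousOn B {p:Fin N → ℝ | ∀
      i, p i ∈ Icc 0 1} ∧ ∀ p:Fin N → ℝ, (∀ i, p i ∈ Icc 0 1) → U p ≠ 0 ∧ ContDiff ℝ (⊤:ℕ∞) (U p) ∧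
      ContDiff ℝ (⊤:ℕ∞) (P p) ∧ VectorCalculus.IsDivFree (U p)∧(∀ y, α p • (cross
      (EuclideanSpace.single 2 1) (U p y)-fderiv ℝ (U p) y (cross (EuclideanSpace.single 2 1)
      y))+(1/2:ℝ) • U p y+(1/2:ℝ) • fderiv ℝ (U p) y y-(Laplacian.laplacian (U p)) y+fderiv ℝ (U p)
      y (U p y)+gradient (P p) y = ∑ j, B p j • D p j y)∧(∀ y, ‖U p y‖≤C₀/(1+‖y‖))∧(∀ y, |P p
      y|≤M)∧(∀ y, ‖y‖≤Rw*√Γ → (∀ j τ, ρ*√Γ/4≤‖y-X p j τ‖) → ‖U p y-u p (X p) y‖≤η*√Γ))) := by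
  rw [transverseReductionR_iff_posCurvature]
  constructor
  · intro h N δ ρ K Λ a b cnd η Rw Rb cg θ₀ hN hδ hρ hη hRw hRb hcg hθ₀ h1 h2 h3 h4 h5 h6 _
    exact h N δ ρ K Λ a b cnd η Rw Rb cg θ₀ hN hδ hρ hη hRw hRb hcg hθ₀ h1 h2 h3 h4 h5 h6
  · intro h N δ ρ K Λ a b cnd η Rw Rb cg θ₀ hN hδ hρ hη hRw hRb hcg hθ₀ h1 h2 h3 h4 h5 h6
    by_cases h7 : (N:ℝ)*ρ^3 ≤ (ρ+2*Rw)^3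
    · exact h N δ ρ K Λ a b cnd η Rw Rb cg θ₀ hN hδ hρ hη hRw hRb hcg hθ₀ h1 h2 h3 h4 h5 h6 h7
    · refine ⟨1, fun Γ hΓ γ α X w c _ _ _ _ _ _ _ _ _ _ _ _ hbox => ?_⟩
      exfalso
      apply h7
      have hΓ0 : 0 < Γ := by linarith
      have hp₀ : ∀ i : Fin N, (fun _ => (0:ℝ)) i ∈ Icc (0:ℝ) 1 := fun _ => ⟨le_rfl, zero_le_one⟩
      obtain ⟨-, -, -, hsep, -, -, -, -, hwaist, -⟩ := hbox.2 (fun _ => (0:ℝ)) hp₀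
      exact packing_of_box hΓ0 hρ hRw hsep hwaist

/-- **The route dichotomy: a vacuous closure of this crux kills the sibling crux.** The box blocks of
`TransverseReductionR` and `SelectionBoxR` (stmt-NavierStokesRegularity-19174) are the same text.  Hence if
the tilted, parameter-bounded box class is EVENTUALLY EMPTY — for every parameter tuple there is `Γ₁` beyond
which no box satisfies the block — then `TransverseReductionR` holds vacuously AND `SelectionBoxR` (which
asserts, for one tuple, a box at every `Γ ≥ Γ₂`) is false; the deciding theorem `closes` of the route
consumes both, so the route cannot be rescued by vacuity.  (For `¬ SelectionBoxR` the maps `u, v, A, T, D`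
are instantiated by their defining formulas.)  With `not_transverseReductionR_iff_boxWitness` (p528784) the
sign of the route is decided at inhabitation: empty ⇒ dead via 19174; inhabited i.o. ⇒ this crux is the
genuine gluing question on those boxes.  Negative-side bookkeeping; NOT a claim about NS regularity or
blow-up. [folklore] -/
theorem transverseReductionR_and_not_selectionBoxR_of_boxEmpty
    (hE : ∀ (N:ℕ) (δ ρ K Λ a b cnd Rw Rb cg θ₀:ℝ), 0 < N → 0 < δ → 0 < ρ → 0 < Rw → 0 < Rb → 0 < cg → 0
      < θ₀ → ∃ Γ₁:ℝ, ∀ Γ:ℝ, Γ₁≤Γ → ∀ (γ:(Fin N → ℝ) → Fin N → ℝ) (α:(Fin N → ℝ) → ℝ) (X:(Fin N → ℝ)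
      → Fin N → ℝ → EuclideanSpace ℝ (Fin 3)) (w:(Fin N → ℝ) → Fin N → ℝ → ℝ) (c:(Fin N → ℝ) → Fin N
      → ℝ) (m n:(Fin N → ℝ) → Fin N → EuclideanSpace ℝ (Fin 3)) (u:(Fin N → ℝ)→(Fin N → ℝ →
      EuclideanSpace ℝ (Fin 3)) → EuclideanSpace ℝ (Fin 3) → EuclideanSpace ℝ (Fin 3)) (v:(Fin N →
      ℝ) → EuclideanSpace ℝ (Fin 3) → EuclideanSpace ℝ (Fin 3)) (A:(Fin N → ℝ) → Fin N →
      (EuclideanSpace ℝ (Fin 3) →L[ℝ] EuclideanSpace ℝ (Fin 3))) (T:(Fin N → ℝ)→(Fin N → ℝ →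
      EuclideanSpace ℝ (Fin 3)) → Fin N → ℝ → EuclideanSpace ℝ (Fin 3)) (D:(Fin N → ℝ) → Fin N →
      EuclideanSpace ℝ (Fin 3) → EuclideanSpace ℝ (Fin 3)), (∀ p Z y, u p Z y = ∑ k, (Γ*γ p
      k/(4*Real.pi)) • ∫ σ:ℝ, ((‖y-Z k σ‖^2+1)^(3/2:ℝ))⁻¹ • cross (deriv (Z k) σ) (y-Z k σ))→(∀ p y,
      v p y = u p (X p) y+(1/2:ℝ) • y-α p • cross (EuclideanSpace.single 2 1) y)→(∀ p j, A p j =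
      fderiv ℝ (v p) (X p j (c p j)))→(∀ p Z j τ, T p Z j τ = (u p Z (Z j τ)+(1/2:ℝ) • Z j τ-α p •
      cross (EuclideanSpace.single 2 1) (Z j τ))-(⟪u p Z (Z j τ)+(1/2:ℝ) • Z j τ-α p • cross
      (EuclideanSpace.single 2 1) (Z j τ), deriv (Z j) τ⟫_ℝ/‖deriv (Z j) τ‖^2) • deriv (Z j) τ)→(∀ p
      j y, D p j y = (Real.exp (-(⟪y-X p j (c p j), deriv (X p j) (c p j)⟫_ℝ)^2)*((1-Real.exp
      (-(‖y-X p j (c p j)‖^2-⟪y-X p j (c p j), deriv (X p j) (c p j)⟫_ℝ^2)))/(‖y-X p j (c p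
      j)‖^2-⟪y-X p j (c p j), deriv (X p j) (c p j)⟫_ℝ^2))) • cross (deriv (X p j) (c p j)) (y-X p j
      (c p j))) → ¬ ((∀ j, ContinuousOn (fun q:(Fin N → ℝ) × ℝ => (α q.1, γ q.1 j, X q.1 j q.2, w
      q.1 j q.2)) ({p:Fin N → ℝ | ∀ i, p i ∈ Icc 0 1} ×ˢ univ))∧(∀ p:Fin N → ℝ, (∀ i, p i ∈ Icc 0 1)
      → α p ≠ 0 ∧ (∀ j, γ p j ≠ 0)∧(∀ j, ContDiff ℝ 2 (X p j) ∧ Differentiable ℝ (w p j)∧(∀ τ,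
      ‖deriv (X p j) τ‖ = 1)∧(∀ τ, ‖iteratedDeriv 2 (X p j) τ‖*√Γ≤K) ∧ Tendsto (fun τ => ‖X p j τ‖)
      (cocompact ℝ) atTop)∧(∀ j k, j ≠ k → ∀ τ σ, ρ*√Γ≤‖X p j τ-X p k σ‖)∧(∀ j τ σ, ρ*√Γ≤|τ-σ| →
      cg*ρ*√Γ≤‖X p j τ-X p j σ‖)∧(∀ j τ, cg*|τ-c p j|≤Rw*√Γ+‖X p j τ‖)∧(∀ j τ, w p j τ = ⟪v p (X p j
      τ), deriv (X p j) τ⟫_ℝ)∧(∀ j τ, ‖X p j τ‖≤Rb*√(Γ*Real.log Γ) → v p (X p j τ) = w p j τ • deriv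
      (X p j) τ)∧(∀ j, ‖X p j (c p j)‖≤Rw*√Γ)∧(∀ j, |⟪deriv (X p j) (c p j), EuclideanSpace.single 2
      1⟫_ℝ|≤1-θ₀)∧(θ₀≤|α p| ∧ |α p|≤θ₀⁻¹ ∧ ∀ j, θ₀≤|γ p j| ∧ |γ p j|≤θ₀⁻¹)∧(∀ j, w p j (c p j) = 0 ∧
      (∀ τ, w p j τ = 0 → τ = c p j) ∧ 3/2+δ≤deriv (w p j) (c p j) ∧ deriv (w p j) (c p j)≤Λ)∧(∀ j,
      Orthonormal ℝ ![deriv (X p j) (c p j), m p j, n p j] ∧ ⟪A p j (m p j), m p j⟫_ℝ+⟪A p j (n p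
      j), n p j⟫_ℝ < 0 ∧ ⟪A p j (n p j), m p j⟫_ℝ * ⟪A p j (m p j), n p j⟫_ℝ < ⟪A p j (m p j), m p
      j⟫_ℝ * ⟪A p j (n p j), n p j⟫_ℝ)∧(∀ Y:Fin N → ℝ → EuclideanSpace ℝ (Fin 3), (∀ j, ContDiff ℝ 2
      (Y j))→(∀ j τ, ⟪Y j τ, deriv (X p j) τ⟫_ℝ = 0) → ∑ j, ⟪Y j (c p j), cross
      (EuclideanSpace.single 2 1) (X p j (c p j))⟫_ℝ = 0 → (∀ j τ, ‖Y j τ‖+‖deriv (Y j)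
      τ‖+‖iteratedDeriv 2 (Y j) τ‖≤(1+|τ-c p j|)^b) → ∀ L:ℝ, (∀ j τ, ‖deriv (fun s:ℝ => T p (fun k σ
      => X p k σ+s • Y k σ) j τ) 0‖≤L*(1+|τ-c p j|)^a) → ∀ j τ, ‖Y j τ‖≤cnd*L*(1+|τ-c p j|)^b)))) :
    TransverseReductionR ∧ ¬ SelectionBoxR := by
  constructor
  · unfold TransverseReductionR
    intro N δ ρ K Λ a b cnd η Rw Rb cg θ₀ hN hδ hρ _ hRw hRb hcg hθ₀
    obtain ⟨Γ₁, hΓ₁⟩ := hE N δ ρ K Λ a b cnd Rw Rb cg θ₀ hN hδ hρ hRw hRb hcg hθ₀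
    refine ⟨Γ₁, fun Γ hΓ γ α X w c m n u v A T D hu hv hA hT hD hbox => ?_⟩
    exact absurd hbox (hΓ₁ Γ hΓ γ α X w c m n u v A T D hu hv hA hT hD)
  · unfold SelectionBoxR
    rintro ⟨N, δ, ρ, K, Λ, a, b, cnd, η, Rw, Rb, cg, θ₀, Γ₂, hN, hδ, hρ, _, _, hRw, hRb, hcg, hθ₀, hall⟩
    obtain ⟨Γ₁, hΓ₁⟩ := hE N δ ρ K Λ a b cnd Rw Rb cg θ₀ hN hδ hρ hRw hRb hcg hθ₀
    set Γ := max Γ₁ Γ₂ with hΓdef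
    obtain ⟨γ, α, X, w, c, m, n, hbox⟩ := hall Γ (le_max_right _ _)
    set u : (Fin N → ℝ) → (Fin N → ℝ → EuclideanSpace ℝ (Fin 3)) → EuclideanSpace ℝ (Fin 3) → EuclideanSpace ℝ (Fin 3) :=
      fun p Z y => ∑ k, (Γ*γ p k/(4*Real.pi)) • ∫ σ:ℝ, ((‖y-Z k σ‖^2+1)^(3/2:ℝ))⁻¹ • cross (deriv (Z
      k) σ) (y-Z k σ) with hu
    set v : (Fin N → ℝ) → EuclideanSpace ℝ (Fin 3) → EuclideanSpace ℝ (Fin 3) :=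
      fun p y => u p (X p) y+(1/2:ℝ) • y-α p • cross (EuclideanSpace.single 2 1) y with hv
    set A : (Fin N → ℝ) → Fin N → (EuclideanSpace ℝ (Fin 3) →L[ℝ] EuclideanSpace ℝ (Fin 3)) :=
      fun p j => fderiv ℝ (v p) (X p j (c p j)) with hA
    set T : (Fin N → ℝ) → (Fin N → ℝ → EuclideanSpace ℝ (Fin 3)) → Fin N → ℝ → EuclideanSpace ℝ (Fin 3) :=
      fun p Z j τ => (u p Z (Z j τ)+(1/2:ℝ) • Z j τ-α p • cross (EuclideanSpace.single 2 1) (Z j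
      τ))-(⟪u p Z (Z j τ)+(1/2:ℝ) • Z j τ-α p • cross (EuclideanSpace.single 2 1) (Z j τ), deriv (Z
      j) τ⟫_ℝ/‖deriv (Z j) τ‖^2) • deriv (Z j) τ with hT
    set D : (Fin N → ℝ) → Fin N → EuclideanSpace ℝ (Fin 3) → EuclideanSpace ℝ (Fin 3) :=
      fun p j y => (Real.exp (-(⟪y-X p j (c p j), deriv (X p j) (c p j)⟫_ℝ)^2)*((1-Real.exp (-(‖y-X
      p j (c p j)‖^2-⟪y-X p j (c p j), deriv (X p j) (c p j)⟫_ℝ^2)))/(‖y-X p j (c p j)‖^2-⟪y-X p j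
      (c p j), deriv (X p j) (c p j)⟫_ℝ^2))) • cross (deriv (X p j) (c p j)) (y-X p j (c p j)) with hD
    have hb := hbox u v A T D (fun _ _ _ => by simp only [hu]) (fun _ _ => by simp only [hv])
      (fun _ _ => by simp only [hA]) (fun _ _ _ _ => by simp only [hT]) (fun _ _ _ => by simp only [hD])
    exact hΓ₁ Γ (le_max_left _ _) γ α X w c m n u v A T D (fun _ _ _ => by simp only [hu])
      (fun _ _ => by simp only [hv]) (fun _ _ => by simp only [hA]) (fun _ _ _ _ => by simp only [hT])
      (fun _ _ _ => by simp only [hD]) hb.1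

end Summit.NavierStokesRegularity.NavierStokesRegularity.Theorems
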